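import Mathlib.LinearAlgebra.Matrix.SchurComplement
import Mathlib.LinearAlgebra.Matrix.Permanent
import Mathlib.LinearAlgebra.Matrix.Charpoly.Coeff
import Mathlib.LinearAlgebra.Dimension.FreeAndStrongRankCondition
import Mathlib.Algebra.Polynomial.Roots
import Mathlib.Tactic.LinearCombination
import Mathlib.Tactic.FinCases
import Literature.Computability.AlgebraicComplexity.RankOneDeterminantalExpressions
import Literature.Computability.AlgebraicComplexity.LRPencilOfMatrix
import HarnessLib

/-!
# Proof of Ikenmeyer–Landsberg 2017, Thm. 2.9 (permanent half):
# `ikenmeyerLandsberg2017_perm_no_rankOne_regular_holds`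

Topic `Literature/Computability/AlgebraicComplexity`; sibling of
`RankOneDeterminantalExpressions.lean`, whose named fact
`ikenmeyerLandsberg2017_perm_no_rankOne_regular` (Ikenmeyer–Landsberg 2017, Thm. 2.9, permanent
half) it DISCHARGES: for `m ≥ 3` the permanent `per_m` has no affine determinantal representation
`per_m = det A`, `A = Λ + Σ_e y^e X^e ∈ M_n(ℂ[y])`, which is regular (`rank Λ = n - 1`) and rank
one (`rank X^e ≤ 1` for all `e`). Theorems only (no new definitions, no new facts).

Source: C. Ikenmeyer, J. M. Landsberg, *On the complexity of the permanent in various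
computational models*, J. Pure Appl. Algebra 221 (2017) 2911–2927 = arXiv:1610.00159
[IkenmeyerLandsberg2017], §6 (p. 10: "Theorem 2.9 will follow from Lemmas 6.2 and 6.3";
Lemma 6.2 p. 10, Lemmas 6.3–6.4 and the proof of 6.3 pp. 10–13 of the arXiv version).

## The printed proof and this formalisation

* **Lemma 6.2** (monotonicity, `rankOne_regular_perPoly_of_succ`): from an expression for
  `per_{m+1}` one gets one for `per_m` by setting the variables of one row and one column to `0`
  except the corner variable, which is set to a constant `y₀ ≠ 0` chosen with
  `rank (Λ + y₀ X^{corner}) ≥ n - 1` ("for almost all `y₀`": here `det` of the complementary minor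
  of the normal form is a nonzero polynomial in `y₀`, `exists_ne_zero_and_le_rank_add_smul`), so
  that `det = y₀ · per_m`; rescaling one row by `y₀⁻¹` gives a regular rank-one expression of
  `per_m` (IL17 use the last row/column and rescale the first row; we use row/column `0` and
  rescale row `0`, immaterial by symmetry; the substitution is the algebra map `aeval g`).
* **Lemma 6.3** (`m = 3`, `perPoly_three_no_rankOne_regular`). IL17 normalise `Λ` to the standard
  form `Λ₀ = diag(0,1,…,1)` (§6.1; here `exists_mul_mul_eq_lamMatrix` of
  `LandsbergRessayreNormalForm.lean`, up to the harmless position `i₀` of the zero and a nonzero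
  constant factor `κ = det V det U`), observe that every monomial of `det A` is carried by
  "first row × entry `(ℓ,k)` × first column" (Lemma 6.4) and run a case analysis using the group
  preserving `det_n` and `Λ₀`. We replace the case analysis by one identity: writing the rank-one
  coefficient matrices as `X^e = c_e r_eᵀ` (`exists_vecMulVec_of_rank_le_one`), the
  Weinstein–Aronszajn identity gives (`det_lamMatrix_add_sum_vecMulVec`)
  `det (Λ₀ + Σ_{l<q} c_l r_lᵀ) = det G_q`, `G_q = [[0, αᵀ], [-γ, 1 + ρ]]` with
  `α_e = c_e(i₀)`, `γ_e = r_e(i₀)`, `ρ_{ef} = r_e · c_f`. Evaluating `det A = κ per_3` at the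
  indicator vectors of one, two and three variables (`q = 1, 2, 3`) yields
  (a) `α_e γ_e = 0`, (b) `α_e ρ_{ef} γ_f = 0`, and (c) the cubic **path identity**
  `Σ_{orderings (a,b,c) of {e,f,g}} α_a ρ_{ab} ρ_{bc} γ_c = κ · per (𝟙_e + 𝟙_f + 𝟙_g)` —
  Lemma 6.4 in closed form: a monomial `y^e y^f y^g` of `per_3` is carried by paths
  first row (`α`) → `(ℓ,k)` entries (`ρ`) → first column (`γ`).
  The **endgame** (`endgame_of_pathSums`) is then short: a nonzero path `a → b → c` forces
  `α_a ≠ 0`, `α_b = γ_b = 0`, `γ_c ≠ 0`; the diagonal transversal carries such a path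
  `(i₁,i₁) → (i₂,i₂) → (i₃,i₃)`; the anti-diagonal transversal `{(i₁,i₃), (i₂,i₂), (i₃,i₁)}` must
  then carry a nonzero path through `(i₂,i₂)`, i.e. `(i₁,i₃) → (i₂,i₂) → (i₃,i₁)` or its reverse,
  and splicing it with the diagonal path produces a nonzero path on three cells with a repeated
  row or column, whose permanent side vanishes — contradiction. (This is exactly the phenomenon
  behind IL17's cases (10e)/(14c)/(16b): a variable forced into a slot already taken.)
* **Assembly** (`ikenmeyerLandsberg2017_perm_no_rankOne_regular_holds`): induction on `m ≥ 3`.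

Regularity is used exactly as in the source: only through the normal form `Λ₀` (rank `n - 1`).

## Contents

0. Linear algebra ([folklore]): `exists_vecMulVec_of_rank_le_one` (rank `≤ 1` ⇒ outer product,
   converse of Mathlib's `Matrix.rank_vecMulVec_le`); the Weinstein–Aronszajn reduction
   `det_lamMatrix_add_sum_vecMulVec` and the expansions of `det G_q = αᵀ adj(1 + ρ) γ` for
   `q = 1, 2, 3` (`det_waMatrix_one/two/three`, `pathSum_of_det_waMatrix_three`); permanents:
   zero column, Laplace expansion along column `0` (`permanent_laplace_col_zero`, the permanent
   twin of `Matrix.det_succ_column_zero`; the same statement is proved as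
   `Matrix.permanent_succ_column_zero` in
   `Literature/Computability/Complexity/OccurrenceObstructionsFresh.lean`, not imported to keep
   this file's imports elementary), `2 × 2`, `3 × 3`.
1. Small permanents of cell-indicator matrices. 2. The endgame. 3. Lemma 6.3 (`m = 3`).
4. Generic rescaling. 5. Lemma 6.2. 6. Theorem 2.9.

Tree: `IsAffineDetRepr`, `perPoly`, `eval_perPoly` (`DeterminantalComplexity.lean`,
`StandardFamilies.lean`); `constPart`, `lamMatrix`, `exists_mul_mul_eq_lamMatrix`,
`Matrix.rank_lt_card_of_det_eq_zero`, `constantCoeff_perPoly` (`LandsbergRessayreNormalForm.lean`);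
`LRPencil.coeffMat`, `LRPencil.eq_affine_of_totalDegree_le_one`, `LRPencil.map_eval_eq`
(`LRPencilOfMatrix.lean`). Mathlib: `Matrix.det_one_add_mul_comm`, `Matrix.det_one_add_smul`,
`Matrix.rank_submatrix_le`, `Matrix.rank_mul_eq_left/right_of_isUnit_det`, `finrank_le_one_iff`,
`Matrix.permanent_permute_cols`, `Finset.univ_perm_fin_succ`.
-/

noncomputable section

open Matrix MvPolynomial

namespace Literature.Computability.AlgebraicComplexity

/-! ### 0. Linear algebra: rank `≤ 1` matrices are outer products -/

section RankOne

variable {K : Type*} [Field K] {m n : Type*} [Fintype n] [DecidableEq n]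

/-- A matrix of rank `≤ 1` over a field is an outer product `c rᵀ` (`vecMulVec c r`): its column
space is spanned by one vector `c`, and column `j` is `r j • c`. (Converse of Mathlib's
`Matrix.rank_vecMulVec_le`.) [folklore] -/
theorem exists_vecMulVec_of_rank_le_one (M : Matrix m n K) (h : M.rank ≤ 1) :
    ∃ (c : m → K) (r : n → K), M = vecMulVec c r := by
  obtain ⟨v, hv⟩ := finrank_le_one_iff.mp h
  have hcol : ∀ j, ∃ a : K, ∀ i, a * (v : m → K) i = M i j := fun j => by
    have hj : M.col j ∈ LinearMap.range M.mulVecLin :=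
      ⟨Pi.single j 1, by rw [Matrix.mulVecLin_apply, Matrix.mulVec_single_one]⟩
    obtain ⟨a, ha⟩ := hv ⟨M.col j, hj⟩
    refine ⟨a, fun i => ?_⟩
    have := congrArg (fun w : LinearMap.range M.mulVecLin => (w : m → K) i) ha
    simpa using this
  choose a ha using hcol
  exact ⟨v, a, Matrix.ext fun i j => by rw [vecMulVec_apply, ← ha j i, mul_comm]⟩

end RankOne

/-! ### 0. Linear algebra: Weinstein–Aronszajn for `Λ_{i₀} +` a sum of outer products -/

section WA

variable {K : Type*} [CommRing K] {ι : Type*} [Fintype ι] [DecidableEq ι]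

/-- **Weinstein–Aronszajn reduction.** For the normal form `Λ_{i₀} = diag(…, 0_{i₀}, …, 1, …)`
(`lamMatrix`) and `q` outer products `c_l r_lᵀ`,
`det (Λ_{i₀} + Σ_l c_l r_lᵀ) = det G` with `G ∈ M_{q+1}`: `G₀₀ = 0`, `G₀,ₖ₊₁ = c_k i₀`,
`Gₗ₊₁,₀ = -r_l i₀`, `Gₗ₊₁,ₖ₊₁ = δₗₖ + r_l ⬝ c_k`. Proof: `Λ_{i₀} + Σ c_l r_lᵀ = 1 + P Q` with
`P = (-e_{i₀} | c_0 | ⋯)`, `Q = (e_{i₀} ; r_0 ; ⋯)`, and `det (1 + P Q) = det (1 + Q P)`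
(`Matrix.det_one_add_mul_comm`). [folklore] -/
theorem det_lamMatrix_add_sum_vecMulVec (i₀ : ι) {q : ℕ} (c r : Fin q → ι → K) :
    (lamMatrix K i₀ + ∑ l, vecMulVec (c l) (r l)).det =
      (Matrix.of (vecCons (vecCons (0 : K) (fun k => c k i₀))
        (fun l => vecCons (-(r l i₀))
          (fun k => (1 : Matrix (Fin q) (Fin q) K) l k + r l ⬝ᵥ c k)))).det := by
  set P : Matrix ι (Fin (q + 1)) K :=
    Matrix.of fun i => vecCons (-(if i = i₀ then (1 : K) else 0)) (fun k => c k i) with hP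
  set Q : Matrix (Fin (q + 1)) ι K :=
    Matrix.of (vecCons (fun j => if j = i₀ then (1 : K) else 0) (fun l => r l)) with hQ
  have h1 : lamMatrix K i₀ + ∑ l, vecMulVec (c l) (r l) = 1 + P * Q := by
    ext i j
    simp only [Matrix.add_apply, Matrix.sum_apply, vecMulVec_apply, lamMatrix_apply,
      Matrix.one_apply, Matrix.mul_apply, hP, hQ, Matrix.of_apply, Fin.sum_univ_succ,
      Matrix.cons_val_zero, Matrix.cons_val_succ]
    by_cases hij : i = j
    · subst hij
      by_cases hi : i = i₀ <;> simp [hi]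
    · by_cases hi : i = i₀ <;> by_cases hj : j = i₀
      · exact absurd (hi.trans hj.symm) hij
      · subst hi; simp [hj, hij]
      · subst hj; simp [hi]
      · simp [hi, hj, hij]
  have h2 : 1 + Q * P = Matrix.of (vecCons (vecCons (0 : K) (fun k => c k i₀))
        (fun l => vecCons (-(r l i₀))
          (fun k => (1 : Matrix (Fin q) (Fin q) K) l k + r l ⬝ᵥ c k))) := by
    ext a b
    simp only [Matrix.add_apply, Matrix.mul_apply, hP, hQ, Matrix.of_apply]
    refine Fin.cases ?_ (fun l => ?_) a <;> refine Fin.cases ?_ (fun k => ?_) b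
    · simp
    · simp [(Fin.succ_ne_zero _).symm]
    · simp [Finset.sum_neg_distrib]
    · simp [dotProduct, Matrix.one_apply]
  rw [h1, det_one_add_mul_comm, h2]

/-- `q = 1`: `det [[0, α], [-γ, 1 + ρ]] = α γ`, i.e. `det (Λ_{i₀} + c rᵀ) = c(i₀) r(i₀)`.
[folklore] -/
theorem det_waMatrix_one (a g : Fin 1 → K) (ρ : Fin 1 → Fin 1 → K) :
    (Matrix.of (vecCons (vecCons (0 : K) a)
        (fun l => vecCons (-(g l)) (fun k => (1 : Matrix (Fin 1) (Fin 1) K) l k + ρ l k)))).det =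
      a 0 * g 0 := by
  rw [det_fin_two]
  simp

/-- `q = 2`: `det G₃ = (1 + tr ρ) (Σₗ αₗ γₗ) - Σₗₖ αₗ ρₗₖ γₖ` (`αᵀ adj(1 + ρ) γ` for `2 × 2` `ρ`).
[folklore] -/
theorem det_waMatrix_two (a g : Fin 2 → K) (ρ : Fin 2 → Fin 2 → K) :
    (Matrix.of (vecCons (vecCons (0 : K) a)
        (fun l => vecCons (-(g l)) (fun k => (1 : Matrix (Fin 2) (Fin 2) K) l k + ρ l k)))).det =
      (1 + ρ 0 0 + ρ 1 1) * (a 0 * g 0 + a 1 * g 1) -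
        (a 0 * ρ 0 0 * g 0 + a 0 * ρ 0 1 * g 1 + a 1 * ρ 1 0 * g 0 + a 1 * ρ 1 1 * g 1) := by
  rw [det_fin_three]
  simp [one_apply]
  ring

/-- `q = 3`: `det G₄ = (1 + e₁ + e₂) S₀ - (1 + e₁) S₁ + S₂` where `e₁ = tr ρ`, `e₂` = sum of the
principal `2 × 2` minors of `ρ`, `S₀ = Σ αₗ γₗ`, `S₁ = Σ αₗ ρₗₖ γₖ`, `S₂ = Σ αₗ ρₗₖ ρₖⱼ γⱼ`
(`αᵀ adj(1 + ρ) γ` with `adj(1 + ρ) = (1 + e₁ + e₂) - (1 + e₁) ρ + ρ²` for `3 × 3` `ρ`).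
[folklore] -/
theorem det_waMatrix_three (a g : Fin 3 → K) (ρ : Fin 3 → Fin 3 → K) :
    (Matrix.of (vecCons (vecCons (0 : K) a)
        (fun l => vecCons (-(g l)) (fun k => (1 : Matrix (Fin 3) (Fin 3) K) l k + ρ l k)))).det =
      (1 + (ρ 0 0 + ρ 1 1 + ρ 2 2) +
          (ρ 0 0 * ρ 1 1 - ρ 0 1 * ρ 1 0 + (ρ 0 0 * ρ 2 2 - ρ 0 2 * ρ 2 0) +
            (ρ 1 1 * ρ 2 2 - ρ 1 2 * ρ 2 1))) * (∑ l, a l * g l) -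
        (1 + (ρ 0 0 + ρ 1 1 + ρ 2 2)) * (∑ l, ∑ k, a l * ρ l k * g k) +
          ∑ l, ∑ k, ∑ j, a l * ρ l k * ρ k j * g j := by
  have h10 : (1 : Fin 4).succAbove 0 = 0 := by decide
  have h11 : (1 : Fin 4).succAbove 1 = 2 := by decide
  have h12 : (1 : Fin 4).succAbove 2 = 3 := by decide
  have h20 : (2 : Fin 4).succAbove 0 = 0 := by decide
  have h21 : (2 : Fin 4).succAbove 1 = 1 := by decide
  have h22 : (2 : Fin 4).succAbove 2 = 3 := by decide
  have h30 : (3 : Fin 4).succAbove 0 = 0 := by decide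
  have h31 : (3 : Fin 4).succAbove 1 = 1 := by decide
  have h32 : (3 : Fin 4).succAbove 2 = 2 := by decide
  rw [det_succ_row_zero, Fin.sum_univ_four]
  simp only [det_fin_three, submatrix_apply, h10, h11, h12, h20, h21, h22, h30, h31, h32,
    Fin.succAbove_zero, of_apply, cons_val_zero, cons_val_one, cons_val_succ,
    Fin.succ_zero_eq_one, Fin.succ_one_eq_two]
  simp [one_apply, Fin.sum_univ_three]
  ring

/-- **The cubic path sum.** If the degree-one and degree-two obstructions vanish,
`αₗ γₗ = 0` and `αₗ ρₗₖ γₖ = 0` for all `l, k`, then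
`det G₄ = Σ_{(l,k,j) ∈ 𝔖₃} αₗ ρₗₖ ρₖⱼ γⱼ` — the six "first row → (ℓ,k) → first column" paths of
IL17 Lemma 6.4 through three distinct variables. [folklore] -/
theorem pathSum_of_det_waMatrix_three (a g : Fin 3 → K) (ρ : Fin 3 → Fin 3 → K)
    (hN : ∀ l, a l * g l = 0) (hM : ∀ l k, a l * ρ l k * g k = 0) :
    (Matrix.of (vecCons (vecCons (0 : K) a)
        (fun l => vecCons (-(g l)) (fun k => (1 : Matrix (Fin 3) (Fin 3) K) l k + ρ l k)))).det =
      a 0 * ρ 0 1 * ρ 1 2 * g 2 + a 0 * ρ 0 2 * ρ 2 1 * g 1 + a 1 * ρ 1 0 * ρ 0 2 * g 2 +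
        a 1 * ρ 1 2 * ρ 2 0 * g 0 + a 2 * ρ 2 0 * ρ 0 1 * g 1 + a 2 * ρ 2 1 * ρ 1 0 * g 0 := by
  rw [det_waMatrix_three]
  simp only [Fin.sum_univ_three]
  linear_combination
    (1 + (ρ 0 0 + ρ 1 1 + ρ 2 2) +
          (ρ 0 0 * ρ 1 1 - ρ 0 1 * ρ 1 0 + (ρ 0 0 * ρ 2 2 - ρ 0 2 * ρ 2 0) +
            (ρ 1 1 * ρ 2 2 - ρ 1 2 * ρ 2 1)) + ρ 0 1 * ρ 1 0 + ρ 0 2 * ρ 2 0) * hN 0 +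
    (1 + (ρ 0 0 + ρ 1 1 + ρ 2 2) +
          (ρ 0 0 * ρ 1 1 - ρ 0 1 * ρ 1 0 + (ρ 0 0 * ρ 2 2 - ρ 0 2 * ρ 2 0) +
            (ρ 1 1 * ρ 2 2 - ρ 1 2 * ρ 2 1)) + ρ 1 0 * ρ 0 1 + ρ 1 2 * ρ 2 1) * hN 1 +
    (1 + (ρ 0 0 + ρ 1 1 + ρ 2 2) +
          (ρ 0 0 * ρ 1 1 - ρ 0 1 * ρ 1 0 + (ρ 0 0 * ρ 2 2 - ρ 0 2 * ρ 2 0) +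
            (ρ 1 1 * ρ 2 2 - ρ 1 2 * ρ 2 1)) + ρ 2 0 * ρ 0 2 + ρ 2 1 * ρ 1 2) * hN 2 +
    (-(1 + (ρ 0 0 + ρ 1 1 + ρ 2 2)) + ρ 0 0) * hM 0 0 +
    (-(1 + (ρ 0 0 + ρ 1 1 + ρ 2 2)) + ρ 0 0 + ρ 1 1) * hM 0 1 +
    (-(1 + (ρ 0 0 + ρ 1 1 + ρ 2 2)) + ρ 0 0 + ρ 2 2) * hM 0 2 +
    (-(1 + (ρ 0 0 + ρ 1 1 + ρ 2 2)) + ρ 1 1 + ρ 0 0) * hM 1 0 +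
    (-(1 + (ρ 0 0 + ρ 1 1 + ρ 2 2)) + ρ 1 1) * hM 1 1 +
    (-(1 + (ρ 0 0 + ρ 1 1 + ρ 2 2)) + ρ 1 1 + ρ 2 2) * hM 1 2 +
    (-(1 + (ρ 0 0 + ρ 1 1 + ρ 2 2)) + ρ 2 2 + ρ 0 0) * hM 2 0 +
    (-(1 + (ρ 0 0 + ρ 1 1 + ρ 2 2)) + ρ 2 2 + ρ 1 1) * hM 2 1 +
    (-(1 + (ρ 0 0 + ρ 1 1 + ρ 2 2)) + ρ 2 2) * hM 2 2

/-- `q = 2` with vanishing degree-one obstructions: `det G₃ = -(α₀ ρ₀₁ γ₁ + α₁ ρ₁₀ γ₀)`.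
[folklore] -/
theorem det_waMatrix_two_of_diag (a g : Fin 2 → K) (ρ : Fin 2 → Fin 2 → K)
    (hN : ∀ l, a l * g l = 0) :
    (Matrix.of (vecCons (vecCons (0 : K) a)
        (fun l => vecCons (-(g l)) (fun k => (1 : Matrix (Fin 2) (Fin 2) K) l k + ρ l k)))).det =
      -(a 0 * ρ 0 1 * g 1 + a 1 * ρ 1 0 * g 0) := by
  rw [det_waMatrix_two]
  linear_combination (1 + ρ 1 1) * hN 0 + (1 + ρ 0 0) * hN 1

end WA

/-! ### 0. Linear algebra: permanents — zero columns, Laplace expansion along column `0` -/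

section Permanent

variable {R : Type*} [CommSemiring R]

/-- A matrix with a zero column has permanent `0` (every product `∏ᵢ M (σ i) i` contains the
factor `M (σ j₀) j₀ = 0`). [folklore] -/
theorem permanent_eq_zero_of_col_eq_zero {ι : Type*} [Fintype ι] [DecidableEq ι]
    (M : Matrix ι ι R) (j₀ : ι) (h : ∀ i, M i j₀ = 0) : M.permanent = 0 := by
  unfold Matrix.permanent
  exact Finset.sum_eq_zero fun σ _ => Finset.prod_eq_zero (Finset.mem_univ j₀) (h _)

open Equiv in
/-- **Laplace expansion of the permanent along column `0`**, the permanent twin of Mathlib's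
`Matrix.det_succ_column_zero` (same proof without signs; also proved, with heavier imports, as
`Matrix.permanent_succ_column_zero` in `OccurrenceObstructionsFresh.lean`). [folklore] -/
theorem permanent_laplace_col_zero {n : ℕ} (A : Matrix (Fin n.succ) (Fin n.succ) R) :
    A.permanent = ∑ i : Fin n.succ, A i 0 * (A.submatrix i.succAbove Fin.succ).permanent := by
  rw [Matrix.permanent, Finset.univ_perm_fin_succ, ← Finset.univ_product_univ]
  simp only [Finset.sum_map, Equiv.toEmbedding_apply, Finset.sum_product]
  refine Finset.sum_congr rfl fun p _ => ?_
  have key : ∀ τ : Perm (Fin n), ∏ i, A (Perm.decomposeFin.symm (p, τ) i) i =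
      A p 0 * ∏ i, A (Equiv.swap 0 p (τ i).succ) i.succ := fun τ => by
    rw [Fin.prod_univ_succ, Perm.decomposeFin_symm_apply_zero]
    simp only [Perm.decomposeFin_symm_apply_succ]
  simp only [key, ← Finset.mul_sum]
  congr 1
  refine Fin.cases ?_ (fun i => ?_) p
  · simp only [Equiv.swap_self, Equiv.refl_apply, Matrix.permanent, submatrix_apply,
      Fin.succAbove_zero]
  · rw [← permanent_permute_cols i.cycleRange, Matrix.permanent]
    refine Finset.sum_congr rfl fun τ _ => Finset.prod_congr rfl fun j _ => ?_
    simp only [submatrix_apply, id, Fin.succAbove_cycleRange]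

/-- One-term Laplace expansion: if column `0` vanishes below the corner then
`per A = A₀₀ · per (A with row and column 0 deleted)`. [folklore] -/
theorem permanent_of_succ_col_zero {n : ℕ} (A : Matrix (Fin (n + 1)) (Fin (n + 1)) R)
    (h : ∀ i : Fin n, A i.succ 0 = 0) :
    A.permanent = A 0 0 * (A.submatrix Fin.succ Fin.succ).permanent := by
  rw [permanent_laplace_col_zero, Fin.sum_univ_succ, Fin.succAbove_zero]
  simp [h]

/-- The permanent of a `2 × 2` matrix. [folklore] -/
theorem permanent_fin_two (A : Matrix (Fin 2) (Fin 2) R) :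
    A.permanent = A 0 0 * A 1 1 + A 1 0 * A 0 1 := by
  rw [permanent_laplace_col_zero, Fin.sum_univ_two, permanent_unique, permanent_unique]
  simp [submatrix_apply, Fin.succAbove, Fin.default_eq_zero]

/-- The permanent of a `3 × 3` matrix, expanded along column `0`. [folklore] -/
theorem permanent_fin_three (A : Matrix (Fin 3) (Fin 3) R) :
    A.permanent = A 0 0 * (A 1 1 * A 2 2 + A 2 1 * A 1 2) +
      A 1 0 * (A 0 1 * A 2 2 + A 2 1 * A 0 2) + A 2 0 * (A 0 1 * A 1 2 + A 1 1 * A 0 2) := by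
  rw [permanent_laplace_col_zero, Fin.sum_univ_three, permanent_fin_two, permanent_fin_two,
    permanent_fin_two]
  simp [submatrix_apply, Fin.succAbove]

end Permanent

/-! ### 1. Small permanents of cell-indicator matrices -/

section SmallPermanents

variable {K : Type*} [Field K]

/-- The anti-diagonal transversal through `(i₂,i₂)`: the indicator matrix of the cells
`(i₁,i₃), (i₂,i₂), (i₃,i₁)` (a transposition matrix) has permanent `1`. [folklore] -/
theorem permanent_cells_swap {i₁ i₂ i₃ : Fin 3} (h12 : i₁ ≠ i₂) (h13 : i₁ ≠ i₃) (h23 : i₂ ≠ i₃) :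
    (Matrix.of fun i j : Fin 3 => (if (i, j) = (i₁, i₃) then (1 : K) else 0) +
      (if (i, j) = (i₂, i₂) then 1 else 0) +
        (if (i, j) = (i₃, i₁) then 1 else 0)).permanent = 1 := by
  fin_cases i₁ <;> fin_cases i₂ <;> fin_cases i₃ <;>
    simp [permanent_fin_three] at h12 h13 h23 ⊢

/-- Three cells `(i₁,i₁), (i₂,i₂), (i₃,i₁)` leave column `i₃` empty: permanent `0`. [folklore] -/
theorem permanent_cells_col {i₁ i₂ i₃ : Fin 3} (h12 : i₁ ≠ i₂) (h13 : i₁ ≠ i₃) (h23 : i₂ ≠ i₃) :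
    (Matrix.of fun i j : Fin 3 => (if (i, j) = (i₁, i₁) then (1 : K) else 0) +
      (if (i, j) = (i₂, i₂) then 1 else 0) +
        (if (i, j) = (i₃, i₁) then 1 else 0)).permanent = 0 := by
  fin_cases i₁ <;> fin_cases i₂ <;> fin_cases i₃ <;>
    simp [permanent_fin_three] at h12 h13 h23 ⊢

/-- Three cells `(i₁,i₁), (i₂,i₂), (i₁,i₃)` leave row `i₃` empty: permanent `0`. [folklore] -/
theorem permanent_cells_row {i₁ i₂ i₃ : Fin 3} (h12 : i₁ ≠ i₂) (h13 : i₁ ≠ i₃) (h23 : i₂ ≠ i₃) :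
    (Matrix.of fun i j : Fin 3 => (if (i, j) = (i₁, i₁) then (1 : K) else 0) +
      (if (i, j) = (i₂, i₂) then 1 else 0) +
        (if (i, j) = (i₁, i₃) then 1 else 0)).permanent = 0 := by
  fin_cases i₁ <;> fin_cases i₂ <;> fin_cases i₃ <;>
    simp [permanent_fin_three] at h12 h13 h23 ⊢

/-- The diagonal: the indicator matrix of `(0,0), (1,1), (2,2)` is `1`, permanent `1`. [folklore] -/
theorem permanent_cells_diag :
    (Matrix.of fun i j : Fin 3 => (if (i, j) = ((0 : Fin 3), (0 : Fin 3)) then (1 : K) else 0) +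
      (if (i, j) = ((1 : Fin 3), (1 : Fin 3)) then 1 else 0) +
        (if (i, j) = ((2 : Fin 3), (2 : Fin 3)) then 1 else 0)).permanent = 1 := by
  simp [permanent_fin_three]

/-- For at most `q` marked cells avoiding column `j₀`, the indicator matrix has permanent `0`.
[folklore] -/
theorem permanent_cells_eq_zero_of_col {q : ℕ} (t : Fin q → Fin 3 × Fin 3) (j₀ : Fin 3)
    (ht : ∀ l, (t l).2 ≠ j₀) :
    (Matrix.of fun i j : Fin 3 => ∑ l, if (i, j) = t l then (1 : K) else 0).permanent = 0 := by
  refine permanent_eq_zero_of_col_eq_zero _ j₀ fun i => ?_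
  rw [Matrix.of_apply]
  refine Finset.sum_eq_zero fun l _ => if_neg fun h => ht l ?_
  rw [← h]

/-- `Fin 3` has an element avoiding two given ones. [folklore] -/
theorem exists_fin_three_ne_ne (a b : Fin 3) : ∃ j : Fin 3, j ≠ a ∧ j ≠ b := by
  revert a b; decide

end SmallPermanents

/-! ### 2. The endgame: path sums cannot reproduce `per_3` -/

section Endgame

variable {K : Type*} [Field K]

/-- **Endgame** (the combinatorial heart of IL17 Lemma 6.3, cf. Lemma 6.4 and cases (10e),
(14c), (16b) of its proof). Data `α, γ : cells → K`, `ρ : cells² → K`, `κ ≠ 0` with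
(a) `α_e γ_e = 0`, (b) `α_e ρ_{ef} γ_f = 0` and (c) the path identity
`Σ_{orderings} α ρ ρ γ = κ · per(𝟙_e + 𝟙_f + 𝟙_g)` for all cells `e, f, g` cannot exist.
Proof: the diagonal carries a nonzero path `(i₁,i₁) → (i₂,i₂) → (i₃,i₃)`, forcing
`α (i₂,i₂) = γ (i₂,i₂) = 0`; the anti-diagonal `{(i₁,i₃),(i₂,i₂),(i₃,i₁)}` then carries
`(i₁,i₃) → (i₂,i₂) → (i₃,i₁)` or its reverse; splicing gives a nonzero path on
`{(i₁,i₁),(i₂,i₂),(i₃,i₁)}` (column `i₃` empty) or on `{(i₁,i₁),(i₂,i₂),(i₁,i₃)}` (row `i₃`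
empty), whose path sum must vanish. [cite: IkenmeyerLandsberg2017, Lemma 6.3] -/
theorem endgame_of_pathSums {α γ : Fin 3 × Fin 3 → K} {ρ : Fin 3 × Fin 3 → Fin 3 × Fin 3 → K}
    {κ : K} (hκ : κ ≠ 0) (hN : ∀ e, α e * γ e = 0) (hM : ∀ e f, α e * ρ e f * γ f = 0)
    (hP : ∀ e f g : Fin 3 × Fin 3,
      α e * ρ e f * ρ f g * γ g + α e * ρ e g * ρ g f * γ f + α f * ρ f e * ρ e g * γ g +
          α f * ρ f g * ρ g e * γ e + α g * ρ g e * ρ e f * γ f + α g * ρ g f * ρ f e * γ e =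
        κ * (Matrix.of fun i j : Fin 3 => (if (i, j) = e then (1 : K) else 0) +
          (if (i, j) = f then 1 else 0) + (if (i, j) = g then 1 else 0)).permanent) :
    False := by
  -- Step 1: the diagonal transversal carries a nonzero path `(i₁,i₁) → (i₂,i₂) → (i₃,i₃)`.
  have hdiag := hP (0, 0) (1, 1) (2, 2)
  rw [permanent_cells_diag, mul_one] at hdiag
  obtain ⟨i₁, i₂, i₃, h12, h13, h23, hw⟩ : ∃ i₁ i₂ i₃ : Fin 3, i₁ ≠ i₂ ∧ i₁ ≠ i₃ ∧ i₂ ≠ i₃ ∧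
      α (i₁, i₁) * ρ (i₁, i₁) (i₂, i₂) * ρ (i₂, i₂) (i₃, i₃) * γ (i₃, i₃) ≠ 0 := by
    by_contra hcon
    push Not at hcon
    apply hκ
    rw [← hdiag, hcon 0 1 2 (by decide) (by decide) (by decide),
      hcon 0 2 1 (by decide) (by decide) (by decide),
      hcon 1 0 2 (by decide) (by decide) (by decide),
      hcon 1 2 0 (by decide) (by decide) (by decide),
      hcon 2 0 1 (by decide) (by decide) (by decide),
      hcon 2 1 0 (by decide) (by decide) (by decide)]
    ring
  -- Step 2: the classes of the three diagonal cells.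
  have hαa : α (i₁, i₁) ≠ 0 := fun h => hw (by rw [h]; ring)
  have hρab : ρ (i₁, i₁) (i₂, i₂) ≠ 0 := fun h => hw (by rw [h]; ring)
  have hρbc : ρ (i₂, i₂) (i₃, i₃) ≠ 0 := fun h => hw (by rw [h]; ring)
  have hγc : γ (i₃, i₃) ≠ 0 := fun h => hw (by rw [h]; ring)
  have hγa : γ (i₁, i₁) = 0 := (mul_eq_zero.mp (hN _)).resolve_left hαa
  have hαb : α (i₂, i₂) = 0 := by
    by_contra h
    rcases mul_eq_zero.mp (hM (i₂, i₂) (i₃, i₃)) with h' | h'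
    · rcases mul_eq_zero.mp h' with h'' | h''
      · exact h h''
      · exact hρbc h''
    · exact hγc h'
  have hγb : γ (i₂, i₂) = 0 := by
    by_contra h
    rcases mul_eq_zero.mp (hM (i₁, i₁) (i₂, i₂)) with h' | h'
    · rcases mul_eq_zero.mp h' with h'' | h''
      · exact hαa h''
      · exact hρab h''
    · exact h h'
  -- Step 3: the anti-diagonal transversal through `(i₂,i₂)`.
  have hx := hP (i₁, i₃) (i₂, i₂) (i₃, i₁)
  rw [permanent_cells_swap h12 h13 h23, mul_one] at hx
  simp only [hαb, hγb, zero_mul, mul_zero, add_zero] at hx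
  -- Step 4: splice.
  by_cases hA : α (i₁, i₃) * ρ (i₁, i₃) (i₂, i₂) * ρ (i₂, i₂) (i₃, i₁) * γ (i₃, i₁) = 0
  · -- the reverse path `(i₃,i₁) → (i₂,i₂) → (i₁,i₃)` is nonzero
    rw [hA, zero_add] at hx
    have hρbx : ρ (i₂, i₂) (i₁, i₃) ≠ 0 := fun h => hκ (by rw [← hx, h]; ring)
    have hγx : γ (i₁, i₃) ≠ 0 := fun h => hκ (by rw [← hx, h]; ring)
    have hN' := hP (i₁, i₁) (i₂, i₂) (i₁, i₃)
    rw [permanent_cells_row h12 h13 h23, mul_zero] at hN'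
    simp only [hαb, hγb, hγa, zero_mul, mul_zero, add_zero] at hN'
    exact mul_ne_zero (mul_ne_zero (mul_ne_zero hαa hρab) hρbx) hγx hN'
  · have hρbx : ρ (i₂, i₂) (i₃, i₁) ≠ 0 := fun h => hA (by rw [h]; ring)
    have hγx : γ (i₃, i₁) ≠ 0 := fun h => hA (by rw [h]; ring)
    have hN' := hP (i₁, i₁) (i₂, i₂) (i₃, i₁)
    rw [permanent_cells_col h12 h13 h23, mul_zero] at hN'
    simp only [hαb, hγb, hγa, zero_mul, mul_zero, add_zero] at hN'
    exact mul_ne_zero (mul_ne_zero (mul_ne_zero hαa hρab) hρbx) hγx hN'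

end Endgame

/-! ### 3. The case `m = 3` (IL17 Lemma 6.3) -/

section Three

/-- Sums against indicator coefficients pick out the marked terms. [folklore] -/
theorem sum_indicator_smul {E : Type*} [Fintype E] [DecidableEq E] {R : Type*} [Semiring R]
    {β : Type*} [AddCommMonoid β] [Module R β] {q : ℕ} (t : Fin q → E) (M : E → β) :
    ∑ x, (∑ l, if x = t l then (1 : R) else 0) • M x = ∑ l, M (t l) := by
  simp_rw [Finset.sum_smul, ite_smul, one_smul, zero_smul]
  rw [Finset.sum_comm]
  simp

/-- **IL17 Lemma 6.3 (permanent)**: `per_3` has no regular rank-one affine determinantal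
representation over `ℂ`. Proof: evaluation `det (Λ + Σ y_e X^e) = per(y)` (`LRPencil.map_eval_eq`),
`X^e = c_e r_eᵀ`, normal form `V Λ U = Λ₀`, Weinstein–Aronszajn at the indicators of one, two,
three cells, and `endgame_of_pathSums`. [cite: IkenmeyerLandsberg2017, Lemma 6.3] -/
theorem perPoly_three_no_rankOne_regular {n : ℕ}
    (A : Matrix (Fin n) (Fin n) (MvPolynomial (Fin 3 × Fin 3) ℂ))
    (hA : IsAffineDetRepr (perPoly (Fin 3) ℂ) A)
    (hreg : (A.map MvPolynomial.constantCoeff).rank + 1 = n)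
    (h1 : ∀ e : Fin 3 × Fin 3,
      (Matrix.of fun i j => MvPolynomial.coeff (Finsupp.single e 1) (A i j)).rank ≤ 1) :
    False := by
  classical
  -- (1) evaluation: `det (Λ + Σ_e y_e X^e) = per (y)`
  have heval : ∀ y : Fin 3 × Fin 3 → ℂ,
      (constPart A + ∑ e, y e • LRPencil.coeffMat A e).det =
        (Matrix.of fun i j => y (i, j)).permanent := fun y => by
    have h := RingHom.map_det (MvPolynomial.eval y) A
    rw [RingHom.mapMatrix_apply, LRPencil.map_eval_eq A hA.1 y, hA.2, eval_perPoly] at h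
    exact h.symm
  -- (2) rank one: `X^e = c_e r_eᵀ`
  have h1' : ∀ e, (LRPencil.coeffMat A e).rank ≤ 1 := h1
  choose c r hcr using fun e => exists_vecMulVec_of_rank_le_one (LRPencil.coeffMat A e) (h1' e)
  -- (3) normal form of `Λ`
  obtain ⟨V, U, i₀, hV, hU, hVU⟩ := exists_mul_mul_eq_lamMatrix (constPart A)
    (by rw [Fintype.card_fin]; change (A.map constantCoeff).rank = n - 1; omega)
    (by rw [Fintype.card_fin]; omega)
  have hκ : V.det * U.det ≠ 0 :=
    mul_ne_zero ((Matrix.isUnit_iff_isUnit_det V).mp hV).ne_zero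
      ((Matrix.isUnit_iff_isUnit_det U).mp hU).ne_zero
  -- (4) the key identity, for every `y`
  have key : ∀ y : Fin 3 × Fin 3 → ℂ,
      (lamMatrix ℂ i₀ + ∑ e, y e • vecMulVec (V *ᵥ c e) (r e ᵥ* U)).det =
        V.det * U.det * (Matrix.of fun i j => y (i, j)).permanent := fun y => by
    have hconj : V * (constPart A + ∑ e, y e • LRPencil.coeffMat A e) * U =
        lamMatrix ℂ i₀ + ∑ e, y e • vecMulVec (V *ᵥ c e) (r e ᵥ* U) := by
      rw [Matrix.mul_add, Matrix.add_mul, hVU, Finset.mul_sum, Finset.sum_mul]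
      refine congrArg _ (Finset.sum_congr rfl fun e _ => ?_)
      rw [Matrix.mul_smul, Matrix.smul_mul, hcr e, Matrix.mul_vecMulVec, Matrix.vecMulVec_mul]
    rw [← hconj, det_mul, det_mul, heval y]
    ring
  -- (5) the key identity at indicator vectors of `q` cells
  have keyt : ∀ {q : ℕ} (t : Fin q → Fin 3 × Fin 3),
      (lamMatrix ℂ i₀ + ∑ l, vecMulVec (V *ᵥ c (t l)) (r (t l) ᵥ* U)).det =
        V.det * U.det *
          (Matrix.of fun i j : Fin 3 => ∑ l, if (i, j) = t l then (1 : ℂ) else 0).permanent := by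
    intro q t
    have h := key (fun x => ∑ l, if x = t l then (1 : ℂ) else 0)
    rwa [sum_indicator_smul] at h
  -- (a) one cell: `α_e γ_e = 0`
  have hN : ∀ e, (V *ᵥ c e) i₀ * (r e ᵥ* U) i₀ = 0 := fun e => by
    have h := keyt ![e]
    have hne : ∀ l : Fin 1, (![e] l).2 ≠ e.2 + 1 := fun l => by
      fin_cases l; simp
    rw [det_lamMatrix_add_sum_vecMulVec, det_waMatrix_one, permanent_cells_eq_zero_of_col _ _ hne,
      mul_zero] at h
    simpa using h
  -- (b) two cells: `α_e ρ_ef γ_f + α_f ρ_fe γ_e = 0`, hence `α_e ρ_ef γ_f = 0`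
  have hB : ∀ e f, (V *ᵥ c e) i₀ * (r e ᵥ* U ⬝ᵥ V *ᵥ c f) * (r f ᵥ* U) i₀ +
      (V *ᵥ c f) i₀ * (r f ᵥ* U ⬝ᵥ V *ᵥ c e) * (r e ᵥ* U) i₀ = 0 := fun e f => by
    have h := keyt ![e, f]
    obtain ⟨j₀, hj₀e, hj₀f⟩ := exists_fin_three_ne_ne e.2 f.2
    have hne : ∀ l : Fin 2, (![e, f] l).2 ≠ j₀ := fun l => by
      fin_cases l
      · simpa using hj₀e.symm
      · simpa using hj₀f.symm
    rw [det_lamMatrix_add_sum_vecMulVec,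
      det_waMatrix_two_of_diag (fun k => (V *ᵥ c (![e, f] k)) i₀) (fun l => (r (![e, f] l) ᵥ* U) i₀)
        (fun l k => r (![e, f] l) ᵥ* U ⬝ᵥ V *ᵥ c (![e, f] k)) (fun l => hN _),
      permanent_cells_eq_zero_of_col _ _ hne, mul_zero, neg_eq_zero] at h
    simpa using h
  have hM : ∀ e f, (V *ᵥ c e) i₀ * (r e ᵥ* U ⬝ᵥ V *ᵥ c f) * (r f ᵥ* U) i₀ = 0 := fun e f => by
    by_cases hαe : (V *ᵥ c e) i₀ = 0
    · rw [hαe, zero_mul, zero_mul]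
    by_cases hγf : (r f ᵥ* U) i₀ = 0
    · rw [hγf, mul_zero]
    have hγe : (r e ᵥ* U) i₀ = 0 := (mul_eq_zero.mp (hN e)).resolve_left hαe
    have h := hB e f
    rwa [hγe, mul_zero, add_zero] at h
  -- (c) three cells: the path identity
  have hP : ∀ e f g : Fin 3 × Fin 3,
      (V *ᵥ c e) i₀ * (r e ᵥ* U ⬝ᵥ V *ᵥ c f) * (r f ᵥ* U ⬝ᵥ V *ᵥ c g) * (r g ᵥ* U) i₀ +
      (V *ᵥ c e) i₀ * (r e ᵥ* U ⬝ᵥ V *ᵥ c g) * (r g ᵥ* U ⬝ᵥ V *ᵥ c f) * (r f ᵥ* U) i₀ +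
      (V *ᵥ c f) i₀ * (r f ᵥ* U ⬝ᵥ V *ᵥ c e) * (r e ᵥ* U ⬝ᵥ V *ᵥ c g) * (r g ᵥ* U) i₀ +
      (V *ᵥ c f) i₀ * (r f ᵥ* U ⬝ᵥ V *ᵥ c g) * (r g ᵥ* U ⬝ᵥ V *ᵥ c e) * (r e ᵥ* U) i₀ +
      (V *ᵥ c g) i₀ * (r g ᵥ* U ⬝ᵥ V *ᵥ c e) * (r e ᵥ* U ⬝ᵥ V *ᵥ c f) * (r f ᵥ* U) i₀ +
      (V *ᵥ c g) i₀ * (r g ᵥ* U ⬝ᵥ V *ᵥ c f) * (r f ᵥ* U ⬝ᵥ V *ᵥ c e) * (r e ᵥ* U) i₀ =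
        V.det * U.det * (Matrix.of fun i j : Fin 3 => (if (i, j) = e then (1 : ℂ) else 0) +
          (if (i, j) = f then 1 else 0) + (if (i, j) = g then 1 else 0)).permanent := by
    intro e f g
    have h := keyt ![e, f, g]
    rw [det_lamMatrix_add_sum_vecMulVec,
      pathSum_of_det_waMatrix_three (fun k => (V *ᵥ c (![e, f, g] k)) i₀)
        (fun l => (r (![e, f, g] l) ᵥ* U) i₀)
        (fun l k => r (![e, f, g] l) ᵥ* U ⬝ᵥ V *ᵥ c (![e, f, g] k))
        (fun l => hN _) (fun l k => hM _ _)] at h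
    simp only [Fin.sum_univ_three, Matrix.cons_val_zero, Matrix.cons_val_one, Matrix.cons_val_two,
      Matrix.tail_cons, Matrix.head_cons] at h
    exact h
  exact endgame_of_pathSums (α := fun e => (V *ᵥ c e) i₀) (γ := fun e => (r e ᵥ* U) i₀)
    (ρ := fun e f => r e ᵥ* U ⬝ᵥ V *ᵥ c f) hκ hN hM hP

end Three

/-! ### 4. Generic rescaling: `rank (Λ + y₀ X) ≥ n - 1` for some `y₀ ≠ 0` -/

section Generic

/-- If `rank Λ = n - 1` then `rank (Λ + y₀ X) ≥ n - 1` for some `y₀ ≠ 0` (IL17, proof of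
Lemma 6.2: "`rank (Λ + y₀ X^{m,m}) ≥ n - 1` for almost all `y₀ ∈ ℂ`"). Proof: in the normal form
`V Λ U = Λ₀` the minor of `Λ₀ + y₀ V X U` complementary to `i₀` is `1 + y₀ M`, whose determinant
is a polynomial in `y₀` with constant term `1` (`Matrix.det_one_add_smul`), nonvanishing off a
finite set, and `ℂ` is infinite. [cite: IkenmeyerLandsberg2017, Lemma 6.2] -/
theorem exists_ne_zero_and_le_rank_add_smul {n : ℕ} (Λ X : Matrix (Fin n) (Fin n) ℂ)
    (hΛ : Λ.rank + 1 = n) : ∃ y₀ : ℂ, y₀ ≠ 0 ∧ n ≤ (Λ + y₀ • X).rank + 1 := by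
  classical
  obtain ⟨V, U, i₀, hV, hU, hVU⟩ := exists_mul_mul_eq_lamMatrix Λ
    (by rw [Fintype.card_fin]; omega) (by rw [Fintype.card_fin]; omega)
  have hVd : IsUnit V.det := (Matrix.isUnit_iff_isUnit_det V).mp hV
  have hUd : IsUnit U.det := (Matrix.isUnit_iff_isUnit_det U).mp hU
  -- the minor of `V X U` complementary to `i₀`, and `det (1 + y M)` as a polynomial in `y`
  set M : Matrix {i // i ≠ i₀} {i // i ≠ i₀} ℂ :=
    (V * X * U).submatrix Subtype.val Subtype.val with hM
  set p : Polynomial ℂ := 1 + Polynomial.C M.trace * Polynomial.X +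
    (det (1 + (Polynomial.X : Polynomial ℂ) • M.map Polynomial.C)).divX.divX *
      Polynomial.X ^ 2 with hp
  have hpeval : ∀ y : ℂ, (1 + y • M).det = p.eval y := fun y => by
    rw [Matrix.det_one_add_smul, hp]
    simp only [Polynomial.eval_add, Polynomial.eval_one, Polynomial.eval_mul, Polynomial.eval_C,
      Polynomial.eval_X, Polynomial.eval_pow]
  have hp0 : p ≠ 0 := fun h0 => by
    have h := hpeval 0
    rw [zero_smul, add_zero, det_one, h0, Polynomial.eval_zero] at h
    exact one_ne_zero h
  obtain ⟨y₀, hy₀⟩ := Infinite.exists_notMem_finset (insert (0 : ℂ) p.roots.toFinset)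
  rw [Finset.mem_insert, not_or, Multiset.mem_toFinset, Polynomial.mem_roots hp0] at hy₀
  refine ⟨y₀, hy₀.1, ?_⟩
  have hdet : (1 + y₀ • M).det ≠ 0 := by rw [hpeval]; exact hy₀.2
  -- rank bookkeeping
  have hsub : (lamMatrix ℂ i₀ + y₀ • (V * X * U)).submatrix Subtype.val Subtype.val =
      1 + y₀ • M := by
    ext ⟨i, hi⟩ ⟨j, hj⟩
    simp [hM, lamMatrix_apply, Matrix.one_apply, hi]
  have hconj : V * (Λ + y₀ • X) * U = lamMatrix ℂ i₀ + y₀ • (V * X * U) := by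
    rw [Matrix.mul_add, Matrix.add_mul, hVU, Matrix.mul_smul, Matrix.smul_mul]
  calc n = Fintype.card {i // i ≠ i₀} + 1 := by
        rw [Fintype.card_subtype_compl, Fintype.card_subtype_eq, Fintype.card_fin]; omega
    _ = (1 + y₀ • M).rank + 1 := by
        rw [Matrix.rank_of_isUnit _
          ((Matrix.isUnit_iff_isUnit_det _).mpr (isUnit_iff_ne_zero.mpr hdet))]
    _ ≤ (lamMatrix ℂ i₀ + y₀ • (V * X * U)).rank + 1 := by
        rw [← hsub]; exact Nat.add_le_add_right (Matrix.rank_submatrix_le _ _ _) 1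
    _ = (Λ + y₀ • X).rank + 1 := by
        rw [← hconj, Matrix.rank_mul_eq_left_of_isUnit_det U _ hUd,
          Matrix.rank_mul_eq_right_of_isUnit_det V _ hVd]

end Generic

/-! ### 5. IL17 Lemma 6.2: a regular rank-one expression of `per_{m+1}` yields one of `per_m` -/

section Reduction

/-- **IL17 Lemma 6.2** (regular rank-`1` case, permanent): if `per_{m+1}` (`m ≥ 1`) has a
regular rank-one affine determinantal representation of size `n` over `ℂ`, so does `per_m`.
Printed proof: set the variables of one row and one column to `0` except the corner one, set the
corner to a generic constant `y₀ ≠ 0` (so that `rank (Λ + y₀ X^{corner}) = n - 1`,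
`exists_ne_zero_and_le_rank_add_smul`), obtaining `det = y₀ · per_m`
(`permanent_of_succ_col_zero`), and rescale one row by `y₀⁻¹`; degrees stay `≤ 1`, the new
constant part is a row-rescaling of `Λ + y₀ X^{corner}` (rank `n - 1`; `≤` because `per_m(0) = 0`)
and the new coefficient matrices are row-rescalings of old ones (rank `≤ 1`). We use row/column
`0` of the variable matrix (IL17: the last ones), immaterial by symmetry.
[cite: IkenmeyerLandsberg2017, Lemma 6.2] -/
theorem rankOne_regular_perPoly_of_succ {m : ℕ} (hm : 1 ≤ m) {n : ℕ}
    (A : Matrix (Fin n) (Fin n) (MvPolynomial (Fin (m + 1) × Fin (m + 1)) ℂ))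
    (hA : IsAffineDetRepr (perPoly (Fin (m + 1)) ℂ) A)
    (hreg : (A.map MvPolynomial.constantCoeff).rank + 1 = n)
    (h1 : ∀ e : Fin (m + 1) × Fin (m + 1),
      (Matrix.of fun i j => MvPolynomial.coeff (Finsupp.single e 1) (A i j)).rank ≤ 1) :
    ∃ B : Matrix (Fin n) (Fin n) (MvPolynomial (Fin m × Fin m) ℂ),
      IsAffineDetRepr (perPoly (Fin m) ℂ) B ∧ (B.map MvPolynomial.constantCoeff).rank + 1 = n ∧
        ∀ e : Fin m × Fin m,
          (Matrix.of fun i j => MvPolynomial.coeff (Finsupp.single e 1) (B i j)).rank ≤ 1 := by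
  classical
  have h1' : ∀ e, (LRPencil.coeffMat A e).rank ≤ 1 := h1
  -- generic `y₀`
  obtain ⟨y₀, hy₀, hrank⟩ :=
    exists_ne_zero_and_le_rank_add_smul (constPart A) (LRPencil.coeffMat A (0, 0)) hreg
  -- the corner substitution `g`: `y₀₀ ↦ y₀`, `y₀ᵥ, yᵤ₀ ↦ 0`, `yᵤ₊₁,ᵥ₊₁ ↦ yᵤᵥ`
  let g : Fin (m + 1) × Fin (m + 1) → MvPolynomial (Fin m × Fin m) ℂ := fun uv =>
    Fin.cases (motive := fun _ => MvPolynomial (Fin m × Fin m) ℂ)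
      (Fin.cases (motive := fun _ => MvPolynomial (Fin m × Fin m) ℂ) (C y₀) (fun _ => 0) uv.2)
      (fun u => Fin.cases (motive := fun _ => MvPolynomial (Fin m × Fin m) ℂ) 0
        (fun v => X (u, v)) uv.2) uv.1
  have g00 : g (0, 0) = C y₀ := rfl
  have g0s : ∀ v : Fin m, g (0, v.succ) = 0 := fun v => rfl
  have gs0 : ∀ u : Fin m, g (u.succ, 0) = 0 := fun u => rfl
  have gss : ∀ u v : Fin m, g (u.succ, v.succ) = X (u, v) := fun u v => rfl
  have hg_cases : ∀ {P : MvPolynomial (Fin m × Fin m) ℂ → Prop},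
      P (C y₀) → P 0 → (∀ u v, P (X (u, v))) → ∀ e, P (g e) := by
    intro P hC h0 hX ⟨u, v⟩
    refine Fin.cases ?_ (fun u' => ?_) u <;> refine Fin.cases ?_ (fun v' => ?_) v
    · exact hC
    · rw [g0s]; exact h0
    · rw [gs0]; exact h0
    · rw [gss]; exact hX _ _
  set φ : MvPolynomial (Fin (m + 1) × Fin (m + 1)) ℂ →ₐ[ℂ] MvPolynomial (Fin m × Fin m) ℂ :=
    aeval g with hφ
  -- entries of `φ A`
  have hφA : ∀ i j, φ (A i j) = C (coeff 0 (A i j)) +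
      ∑ e, C (coeff (Finsupp.single e 1) (A i j)) * g e := fun i j => by
    conv_lhs => rw [LRPencil.eq_affine_of_totalDegree_le_one (A i j) (hA.1 i j)]
    simp [hφ, map_sum, MvPolynomial.algebraMap_eq]
  -- the rescaled matrix `B = diag(y₀⁻¹, 1, …, 1) · φ(A)`
  have hn : 0 < n := by omega
  set d : Fin n → ℂ := fun i => if i = ⟨0, hn⟩ then y₀⁻¹ else 1 with hd
  set B : Matrix (Fin n) (Fin n) (MvPolynomial (Fin m × Fin m) ℂ) :=
    Matrix.of fun i j => C (d i) * φ (A i j) with hB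
  have hBeq : B = (Matrix.diagonal d).map C * A.map φ := by
    rw [Matrix.diagonal_map (map_zero C)]
    ext i j
    rw [Matrix.diagonal_mul, hB, Matrix.of_apply, Matrix.map_apply]
  have hdunit : IsUnit (Matrix.diagonal d).det := by
    rw [det_diagonal]
    simp [hd, Finset.prod_ite_eq', hy₀]
  -- (i) degrees
  have hg1 : ∀ e, (g e).totalDegree ≤ 1 :=
    hg_cases (P := fun p => p.totalDegree ≤ 1) (by simp) (by simp) (fun u v => by simp)
  have hdegB : ∀ i j, (B i j).totalDegree ≤ 1 := fun i j => by
    rw [hB, Matrix.of_apply]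
    refine (totalDegree_mul _ _).trans ?_
    rw [totalDegree_C, zero_add, hφA]
    refine (totalDegree_add _ _).trans (max_le (by simp) ?_)
    refine totalDegree_finsetSum_le fun e _ => (totalDegree_mul _ _).trans ?_
    rw [totalDegree_C, zero_add]
    exact hg1 e
  -- (ii) determinant: `φ (per_{m+1}) = y₀ · per_m`
  have hper : φ (perPoly (Fin (m + 1)) ℂ) = C y₀ * perPoly (Fin m) ℂ := by
    have hφper : φ (perPoly (Fin (m + 1)) ℂ) = (Matrix.of fun i j => g (i, j)).permanent := by
      simp [hφ, perPoly, Matrix.permanent, map_sum, map_prod]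
    rw [hφper, permanent_of_succ_col_zero _ (fun i => gs0 i), Matrix.of_apply, g00]
    -- the complementary block is literally `Matrix.mvPolynomialX (Fin m) (Fin m) ℂ`
    rfl
  have hdetB : B.det = perPoly (Fin m) ℂ := by
    have hdd : ((Matrix.diagonal d).map (C : ℂ →+* MvPolynomial (Fin m × Fin m) ℂ)).det =
        C y₀⁻¹ := by
      rw [← RingHom.mapMatrix_apply, ← RingHom.map_det, det_diagonal]
      simp [hd, Finset.prod_ite_eq']
    rw [hBeq, det_mul, hdd, ← AlgHom.mapMatrix_apply, ← AlgHom.map_det, hA.2, hper, ← mul_assoc,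
      ← map_mul, inv_mul_cancel₀ hy₀, map_one, one_mul]
  -- (iii) constant parts: `B(0) = diag(d) (Λ + y₀ X^{(0,0)})`
  have hg0 : ∀ e, constantCoeff (g e) = if e = (0, 0) then y₀ else 0 := by
    rintro ⟨u, v⟩
    refine Fin.cases ?_ (fun u' => ?_) u <;> refine Fin.cases ?_ (fun v' => ?_) v
    · rw [g00, constantCoeff_C, if_pos rfl]
    · rw [g0s, map_zero, if_neg (by simp [Fin.succ_ne_zero])]
    · rw [gs0, map_zero, if_neg (by simp [Fin.succ_ne_zero])]
    · rw [gss, constantCoeff_X, if_neg (by simp [Fin.succ_ne_zero])]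
  have hconstB : B.map constantCoeff =
      Matrix.diagonal d * (constPart A + y₀ • LRPencil.coeffMat A (0, 0)) := by
    ext i j
    rw [Matrix.map_apply, hB, Matrix.of_apply, map_mul, constantCoeff_C, hφA, Matrix.diagonal_mul]
    simp only [map_add, map_sum, map_mul, constantCoeff_C, hg0, mul_ite, mul_zero,
      Finset.sum_ite_eq', Finset.mem_univ, if_true, Matrix.add_apply, constPart_apply,
      Matrix.smul_apply, LRPencil.coeffMat_apply, smul_eq_mul, constantCoeff_eq]
    ring
  -- (iv) coefficient matrices: `coeffMat B (a,b) = diag(d) · coeffMat A (a+1, b+1)`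
  have hgc : ∀ (e' : Fin m × Fin m) (e : Fin (m + 1) × Fin (m + 1)),
      coeff (Finsupp.single e' 1) (g e) = if e = (e'.1.succ, e'.2.succ) then 1 else 0 := by
    rintro ⟨a, b⟩ ⟨u, v⟩
    have h0 : ¬ ((0 : Fin m × Fin m →₀ ℕ) = Finsupp.single (a, b) 1) := fun h =>
      one_ne_zero (Finsupp.single_eq_zero.mp h.symm)
    refine Fin.cases ?_ (fun u' => ?_) u <;> refine Fin.cases ?_ (fun v' => ?_) v
    · rw [g00, coeff_C, if_neg h0, if_neg (by simp [(Fin.succ_ne_zero _).symm])]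
    · rw [g0s, coeff_zero, if_neg (by simp [(Fin.succ_ne_zero _).symm])]
    · rw [gs0, coeff_zero, if_neg (by simp [(Fin.succ_ne_zero _).symm])]
    · rw [gss, MvPolynomial.coeff_X]
      simp [Finsupp.single_left_inj one_ne_zero, Prod.ext_iff]
  have hcoeffB : ∀ e' : Fin m × Fin m, LRPencil.coeffMat B e' =
      Matrix.diagonal d * LRPencil.coeffMat A (e'.1.succ, e'.2.succ) := fun e' => by
    have h0 : ¬ ((0 : Fin m × Fin m →₀ ℕ) = Finsupp.single e' 1) := fun h =>
      one_ne_zero (Finsupp.single_eq_zero.mp h.symm)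
    ext i j
    rw [LRPencil.coeffMat_apply, hB, Matrix.of_apply, coeff_C_mul, hφA, Matrix.diagonal_mul,
      LRPencil.coeffMat_apply]
    simp only [coeff_add, coeff_C, if_neg h0, coeff_sum, coeff_C_mul, hgc, mul_ite, mul_one,
      mul_zero, Finset.sum_ite_eq', Finset.mem_univ, if_true, zero_add]
  -- conclusion
  refine ⟨B, ⟨hdegB, hdetB⟩, le_antisymm ?_ ?_, fun e' => ?_⟩
  · have hdet0 : (B.map constantCoeff).det = 0 := by
      rw [← RingHom.mapMatrix_apply, ← RingHom.map_det, hdetB, constantCoeff_perPoly ℂ hm]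
    have h := Matrix.rank_lt_card_of_det_eq_zero hdet0
    rw [Fintype.card_fin] at h
    omega
  · rw [hconstB, Matrix.rank_mul_eq_right_of_isUnit_det _ _ hdunit]
    exact hrank
  · change (LRPencil.coeffMat B e').rank ≤ 1
    rw [hcoeffB, Matrix.rank_mul_eq_right_of_isUnit_det _ _ hdunit]
    exact h1' _

end Reduction

/-! ### 6. Theorem 2.9 (permanent half) -/

/-- **Ikenmeyer–Landsberg 2017, Theorem 2.9 (permanent half), discharged**: for `m ≥ 3`, `per_m`
admits no regular rank-one affine determinantal representation over `ℂ`, of any size. Induction on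
`m ≥ 3`: Lemma 6.3 (`perPoly_three_no_rankOne_regular`) and Lemma 6.2
(`rankOne_regular_perPoly_of_succ`). [cite: IkenmeyerLandsberg2017, Theorem 2.9] -/
theorem ikenmeyerLandsberg2017_perm_no_rankOne_regular_holds :
    ikenmeyerLandsberg2017_perm_no_rankOne_regular := by
  intro m hm
  induction m, hm using Nat.le_induction with
  | base => intro n A hA hreg h1; exact perPoly_three_no_rankOne_regular A hA hreg h1
  | succ m hm ih =>
    intro n A hA hreg h1
    obtain ⟨B, hB, hBreg, hB1⟩ := rankOne_regular_perPoly_of_succ (by omega) A hA hreg h1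
    exact ih n B hB hBreg hB1

end Literature.Computability.AlgebraicComplexity
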